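import Literature.IUT.HodgeArakelov.ThetaEnvDataRecordBridge
import Mathlib.GroupTheory.OrderOfElement

/-!
# [IUTchII] Cor 3.5 (ii) / Cor 3.6 (ii): the `∞`-level junction binders `hroots` and `hΘU` AT THE PRODUCED RECORD
# `ThetaEnvData.toRecord` — from Prop 1.4's DEFINITION of `∞θ(Π)` (proof-only companion to abc-iut-w4-d019's
# `ThetaEnvDataRecordBridge.lean`)

S. Mochizuki, *Inter-universal Teichmüller theory II*, kurims Dec-2020 manuscript: Prop 1.4 p. 27 ("`∞θ(Π)` … denotes
the subset of elements of the direct limit … for which some [positive integer] multiple coincides, up to torsion, with an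
element of `θ(Π)`"), Prop 3.1 (i) p. 87 ("`∞Ψ^ι_env := M^×_TM · ∞θ^ι_env^ℕ`"), Cor 3.5 (ii) p. 95 (bracket l. 3–7 on the
writer's render paper:url-5036b4059555: the `N`-th roots "are uniquely determined, up to multiplication by an element of
the `N`-torsion subgroup"), Cor 3.6 (ii) p. 100 [cite: Mochizuki2012, Cor 3.5 (ii) p.95]. Claim key DISPUTED (D-0012);
nothing disputed is asserted here — every theorem below is elementary algebra over the REAL record of
abc-iut-w4-d019's bridge. PROOF-ONLY companion (abc-iut cell, layer L6, seat abc-iut-w5-d192 gen 3; node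
**IUTchII:Cor3.6(ii)** «↷» at the `∞`-level, sub-DAG `plan/L6/SUBDAG-IUTchII-Cor-36.md` row Cor-36.ii.r9, residual
`∞`-binders; also the `hroots`/`hΘU` binders of NODES IUTchII:Cor3.5(ii)). NO definition, NO `Prop` fact; hypotheses
inline in Mathlib vocabulary.

WHY THIS FILE. The `∞`-level Cor 3.5 (ii) / Cor 3.6 (ii) files (abc-iut-w5-d131
`pi_restriction_inftyThetaMonoid_upToTorsion_of_kummer_of_fixed`, `inftyThetaMonoid_conjStable_of_kummer`, p417474 /
p416348; abc-iut-w5-d192 `comap_piIso_map_inftyThetaMonoid_diagonalStable_upToTorsion`, p420309) carry, over an ABSTRACT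
Prop 3.1 input record `E : TemperedThetaMonoids.ThetaEnvData`, two binders about the roots `∞θ^ι_env`:
* `hroots : ∀ ϑ ∈ ∞θ^ι_env, ∃ N > 0, ϑ ^ N ∈ M^×_TM · θ^ℕ` (print's root condition, Prop 1.4 p. 27);
* `hΘU : ∀ g t, ∀ ϑ ∈ ∞θ^ι_env, ∃ u ∈ M^×_TM, conj (s_t g) ϑ = u · ϑ` (the Cor 3.5 (ii) bracket p. 95: Galois moves a root
  by a unit).
For the record PRODUCED by abc-iut-w4-d019's bridge `T.toRecord act κ iota` — where `∞θ^ι_env :=` the transport along the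
cyclotomic rigidity isomorphism of the `ι`-invariants up to torsion of `∞θ(Π)`, and `∞θ(Π)` IS abc-iut-L6-t1's typing of
the printed DEFINITION (`EtaleThetaData.thetaInfty`) — both binders are CONSEQUENCES of `Ψ`-level inputs already
discharged or named elsewhere:
* `exists_pow_eq_unit_mul_of_mem_toRecord_inftyThetaEnv'` / **`hroots_toRecord_of_horb`**: `hroots` follows from `horb`
  ("`θ^ι_env` is one `M^×_TM`-orbit of `θ`" — abc-iut-w4-d004 `horb_toRecord`) and `htors` ("`M^μ_TM ⊆ M^×_TM`" —
  abc-iut-w4-d004 `units_of_isOfFinOrder_thetaEnvRecordKummer` at the genuine record) ALONE, for ANY label `ι` and any `θ`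
  (no inversion datum). Key step (`toLim_mem_thetaIotaLim_of_nsmul`): if `n · x ≡ y` modulo torsion and `x` is `ι`-invariant
  up to torsion, then so is `y`; so the element of `θ(Π)` that a root `x ∈ ∞θ^ι(Π)` is a root OF lies itself in `θ^ι(Π)`, its
  transport lies in `θ^ι_env = M^×_TM · θ`, and the torsion discrepancy is a unit. (The discharge OF RECORD of `hroots` at the
  label `i₀` of a Prop 2.2 (ii)′ datum `Θ : IotaInvariantTheta'` — inputs `hker`, `hi₀`, `htors` — is abc-iut-w4-d004's
  `BadPrimeGaussianMonoids.hroots_toRecord`, `…RecordRootsProofs.lean` p427094, landed while this file was written; the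
  `horb`-form here is the shape the `hΘU` derivation below consumes.)
* **`hThetaU_toRecord`**: `hΘU` follows from the same two inputs plus `hfix` (`conj g θ = θ`, the Cor 3.5 (ii) junction
  discharged at the cohomology model by abc-iut-w4-d004, p417978), the conjugation-stability of `Ψ_cns` (Prop 3.1 (ii),
  abc-iut-w4-d007 `constants_stable_of_equivariant_mrange`; `toRecord_units_conj_stable` derives that of `M^×_TM`), and
  ONE saturation input `hsat : x ^ n ∈ M^×_TM ⇒ x ∈ M^×_TM` (`0 < n`) on the ambient module — at the genuine record this
  is Kummer theory of `k̄` (`n`-th roots exist in `k̄ˣ`, the torsion of `lim H¹` is `κ(μ)`, `𝒪^×_{k̄}` is root-closed);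
  it is stated here as the inline hypothesis it is, never as a `Prop` fact.
HONEST FRAMING: elementary algebra on a definitional bridge; it narrows the residual set of NODES IUTchII:Cor3.6 (the two
`∞`-binders become `horb` + `htors` + `hfix` + `hsat`); it discharges no disputed claim and takes no side on [IUTchIII]
Cor 3.12; typed ≠ proved ≠ endorsed. TYPING NOTE: the record's ambient type `(T.toRecord act κ iota).H` is
`CommGrpCat.of (Multiplicative T.cohEnv.lim)`; the working lemmas (primed) are stated over `Multiplicative T.cohEnv.lim`
and the headline theorems over the record's own carrier, exactly in the binder shapes of the consuming files.
-/

namespace Literature.IUT.HodgeArakelov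

namespace ThetaEnvData

open TemperedThetaMonoids

universe u

/-- Differences of elements of finite additive order have finite additive order (additive commutative group).
[folklore] -/
private theorem isOfFinAddOrder_sub_aux {L : Type*} [AddCommGroup L] {a b : L} (ha : IsOfFinAddOrder a)
    (hb : IsOfFinAddOrder b) : IsOfFinAddOrder (a - b) := by
  rw [sub_eq_add_neg]
  exact ha.add hb.neg

variable {S : ThetaSetting.{u}} {F : ModelFamily S} {Sys : MonoThetaProjSystem F} (T : ThetaEnvData Sys)
  (act : Sys.PiX →* MulAut (Multiplicative T.cohEnv.lim)) {M : Type u} [CommMonoid M]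
  (κ : M →* Multiplicative T.cohEnv.lim) {Iota : Type u} (iota : Iota → (T.D.coh.lim ≃+ T.D.coh.lim))

/-! ### `ι`-invariance up to torsion passes from a root to the element it is a root of -/

/-- If `n • x - y` is torsion and `e x - x` is torsion (`x` is `ι`-invariant up to torsion for the action `e` of `ι` on the
limit), then `e y - y` is torsion. (Additive bookkeeping behind [IUTchII] Prop 1.4 / Prop 2.2 (ii): a positive multiple of an
`ι`-invariant-up-to-torsion root that "coincides up to torsion" with `y` forces `y` to be `ι`-invariant up to torsion.)
[claim: Mochizuki2012, status: disputed] (IUTchII §2 Prop 2.2 (ii), kurims p.66) -/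
theorem isOfFinAddOrder_apply_sub_of_nsmul (e : T.D.coh.lim ≃+ T.D.coh.lim) {x y : T.D.coh.lim} {n : ℕ}
    (hxy : IsOfFinAddOrder (n • x - y)) (hx : IsOfFinAddOrder (e x - x)) : IsOfFinAddOrder (e y - y) := by
  have key : e y - y = n • (e x - x) - (e (n • x - y) - (n • x - y)) := by
    simp only [map_sub, map_nsmul, smul_sub]
    abel
  rw [key]
  exact isOfFinAddOrder_sub_aux (IsOfFinAddOrder.nsmul (n := n) hx)
    (isOfFinAddOrder_sub_aux ((e : T.D.coh.lim →+ T.D.coh.lim).isOfFinAddOrder hxy) hxy)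

/-- For `x ∈ ∞θ^ι(Π)` (an `ι`-invariant-up-to-torsion element of `∞θ(Π)`), the element `toLim t`, `t ∈ θ(Π)`, with which a
positive multiple `n • x` coincides up to torsion (Prop 1.4's DEFINITION of `∞θ(Π)`) lies in `θ^ι(Π)` (limit form
`thetaIotaLim`). [claim: Mochizuki2012, status: disputed] (IUTchII §1 Prop 1.4, kurims p.27) -/
theorem toLim_mem_thetaIotaLim_of_nsmul (e : T.D.coh.lim ≃+ T.D.coh.lim) {x : T.D.coh.lim}
    (hx : IsOfFinAddOrder (e x - x)) {n : ℕ} {t : T.D.coh.H1 ⊤} (ht : t ∈ T.D.theta)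
    (hxt : IsOfFinAddOrder (n • x - T.D.coh.toLim ⊤ t)) : T.D.coh.toLim ⊤ t ∈ T.thetaIotaLim e :=
  (T.mem_thetaIotaLim_iff e _).2 ⟨⟨t, ht, rfl⟩, T.isOfFinAddOrder_apply_sub_of_nsmul e hxt hx⟩

/-! ### `hroots` at the record -/

/-- Working form (elements typed in `Multiplicative T.cohEnv.lim`): **every root `ϑ ∈ ∞θ^ι_env(M^Θ_*)` of the produced
record has a positive power of the form `v · θ`, `v ∈ M^×_TM`** — GIVEN `horb` ("`θ^ι_env` is one `M^×_TM`-orbit of `θ`",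
abc-iut-w4-d004 `horb_toRecord`) and `htors` ("`M^μ_TM ⊆ M^×_TM`"). Proof = Prop 1.4's definition of `∞θ(Π)` read
through the bridge: `n · x = toLim t + τ` with `t ∈ θ(Π)`, `τ` torsion; `toLim t ∈ θ^ι(Π)`
(`toLim_mem_thetaIotaLim_of_nsmul`), so its transport is `u · θ`; the transport of `τ` is a torsion unit.
[claim: Mochizuki2012, status: disputed] (IUTchII §3 Cor 3.5 (ii), kurims p.95) -/
theorem exists_pow_eq_unit_mul_of_mem_toRecord_inftyThetaEnv' (ι : Iota) {θ ϑ : Multiplicative T.cohEnv.lim}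
    (horb : ∀ θ' : Multiplicative T.cohEnv.lim, θ' ∈ (T.toRecord act κ iota).thetaEnv ι →
      ∃ u : Multiplicative T.cohEnv.lim, u ∈ (T.toRecord act κ iota).units ∧ θ' = u * θ)
    (htors : ∀ u : Multiplicative T.cohEnv.lim, IsOfFinOrder u → u ∈ (T.toRecord act κ iota).units)
    (hϑ : ϑ ∈ (T.toRecord act κ iota).inftyThetaEnv ι) :
    ∃ n : ℕ, 0 < n ∧ ∃ v : Multiplicative T.cohEnv.lim, v ∈ (T.toRecord act κ iota).units ∧ ϑ ^ n = v * θ := by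
  -- unfold membership in `∞θ^ι_env = envSet (thetaInftyIotaLim (iota ι))`
  have hx := (T.mem_envSet_iff (T.thetaInftyIotaLim (iota ι)) ϑ).1 hϑ
  rw [mem_thetaInftyIotaLim_iff] at hx
  obtain ⟨⟨n, hn, t, ht, hxt⟩, hinv⟩ := hx
  set x : T.D.coh.lim := T.transportLim.symm (Multiplicative.toAdd ϑ) with hxdef
  -- the element `toLim t` lies in `θ^ι(Π)`, so its transport lies in `θ^ι_env` of the record
  have hmem : Multiplicative.ofAdd (T.transportLim (T.D.coh.toLim ⊤ t)) ∈ (T.toRecord act κ iota).thetaEnv ι :=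
    (T.mem_envSet_iff (T.thetaIotaLim (iota ι)) _).2
      (by simpa only [toAdd_ofAdd, AddEquiv.symm_apply_apply] using
        T.toLim_mem_thetaIotaLim_of_nsmul (iota ι) hinv ht hxt)
  obtain ⟨u, hu, hueq⟩ := horb _ hmem
  -- the torsion discrepancy `τ := n • x - toLim t`, transported, is a unit
  set τ : T.D.coh.lim := n • x - T.D.coh.toLim ⊤ t with hτdef
  have hτtors : IsOfFinOrder (Multiplicative.ofAdd (T.transportLim τ)) :=
    isOfFinOrder_ofAdd_iff.2 ((T.transportLim : T.D.coh.lim →+ T.cohEnv.lim).isOfFinAddOrder hxt)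
  refine ⟨n, hn, u * Multiplicative.ofAdd (T.transportLim τ),
    (T.toRecord act κ iota).units.mul_mem hu (htors _ hτtors), ?_⟩
  -- `ϑ ^ n = transport (n • x) = transport (toLim t) * transport τ = (u * θ) * transport τ`
  have hϑx : ϑ = Multiplicative.ofAdd (T.transportLim x) := by
    rw [hxdef, AddEquiv.apply_symm_apply, ofAdd_toAdd]
  have hnx : n • x = T.D.coh.toLim ⊤ t + τ := by rw [hτdef]; abel
  calc ϑ ^ n = Multiplicative.ofAdd (T.transportLim (n • x)) := by rw [hϑx, ← ofAdd_nsmul, ← map_nsmul]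
    _ = Multiplicative.ofAdd (T.transportLim (T.D.coh.toLim ⊤ t)) * Multiplicative.ofAdd (T.transportLim τ) := by
        rw [hnx, map_add, ofAdd_add]
    _ = u * θ * Multiplicative.ofAdd (T.transportLim τ) := by rw [hueq]
    _ = u * Multiplicative.ofAdd (T.transportLim τ) * θ := mul_right_comm _ _ _

/-- **`hroots` HOLDS at the produced record, `horb`-form** ([IUTchII] Prop 1.4 p. 27 root condition, as the binder
`hroots` of abc-iut-w5-d131's `pi_restriction_inftyThetaMonoid_upToTorsion_of_kummer_of_fixed` (p417474) / abc-iut-w5-d192's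
`comap_piIso_map_inftyThetaMonoid_diagonalStable_upToTorsion` (p420309), instantiated at `E := T.toRecord act κ iota`):
for ANY label `ι`, every `ϑ ∈ ∞θ^ι_env(M^Θ_*)` has a positive power in `M^×_TM · θ^ℕ`, GIVEN `horb` (the conclusion of
abc-iut-w4-d004's `horb_toRecord`, verbatim) and `htors` ("`M^μ_TM ⊆ M^×_TM`", its binder verbatim). Companion of
abc-iut-w4-d004's `BadPrimeGaussianMonoids.hroots_toRecord` (p427094: the label `i₀` of a Prop 2.2 (ii)′ datum, inputs
`hker`/`hi₀`/`htors`). [claim: Mochizuki2012, status: disputed] (IUTchII §3 Cor 3.5 (ii), kurims p.95) -/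
theorem hroots_toRecord_of_horb (ι : Iota) {θ : (T.toRecord act κ iota).H}
    (horb : ∀ θ' ∈ (T.toRecord act κ iota).thetaEnv ι, ∃ u ∈ (T.toRecord act κ iota).units, θ' = u * θ)
    (htors : ∀ u : (T.toRecord act κ iota).H, IsOfFinOrder u → u ∈ (T.toRecord act κ iota).units) :
    ∀ ϑ ∈ (T.toRecord act κ iota).inftyThetaEnv ι, ∃ N : ℕ, 0 < N ∧
      ϑ ^ N ∈ splitMonoid (T.toRecord act κ iota).units (Submonoid.powers θ) := by
  intro ϑ hϑ
  obtain ⟨n, hn, v, hv, h⟩ := T.exists_pow_eq_unit_mul_of_mem_toRecord_inftyThetaEnv' act κ iota ι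
    (fun θ' h' => horb θ' h') (fun u hu => htors u hu) hϑ
  exact ⟨n, hn, (mem_splitMonoid_iff _ _ _).2 ⟨v, hv, θ, Submonoid.mem_powers _, h.symm⟩⟩

/-! ### `hΘU` at the record -/

/-- Working form: `M^×_TM` of the produced record is stable under `act g` whenever `Ψ_cns = κ(M_TM)` is
([IUTchII] Prop 3.1 (ii) "natural conjugation action"; `Ψ_cns` is conjugation-stable for an equivariant Kummer map —
abc-iut-w4-d007 `constants_stable_of_equivariant_mrange`, p412769): units go to units.
[claim: Mochizuki2012, status: disputed] (IUTchII §3 Prop 3.1 (ii), kurims p.88) -/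
theorem toRecord_units_conj_stable' (g : Sys.PiX)
    (hcns : ∀ c : Multiplicative T.cohEnv.lim, c ∈ (T.toRecord act κ iota).constantMonoid →
      act g c ∈ (T.toRecord act κ iota).constantMonoid)
    {u : Multiplicative T.cohEnv.lim} (hu : u ∈ (T.toRecord act κ iota).units) :
    act g u ∈ (T.toRecord act κ iota).units := by
  have hu' : u ∈ MonoidHom.mrange κ ∧ u⁻¹ ∈ MonoidHom.mrange κ := hu
  have h1 : act g u ∈ MonoidHom.mrange κ := hcns _ hu'.1
  have h2 : act g u⁻¹ ∈ MonoidHom.mrange κ := hcns _ hu'.2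
  have h3 : (act g u)⁻¹ = act g u⁻¹ := (map_inv (act g) u).symm
  exact ⟨h1, h3 ▸ h2⟩

/-- `M^×_TM` of the produced record is stable under the conjugation action, given the conjugation-stability of `Ψ_cns`
(`IsConjStable`, the output of abc-iut-w4-d007's `constants_stable_of_equivariant_mrange` for the record, whose `conj` IS
`act`). [claim: Mochizuki2012, status: disputed] (IUTchII §3 Prop 3.1 (ii), kurims p.88) -/
theorem toRecord_units_conj_stable (hcns : (T.toRecord act κ iota).IsConjStable (T.toRecord act κ iota).constantMonoid)
    (g : Sys.PiX) {u : (T.toRecord act κ iota).H} (hu : u ∈ (T.toRecord act κ iota).units) :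
    (T.toRecord act κ iota).conj g u ∈ (T.toRecord act κ iota).units :=
  T.toRecord_units_conj_stable' act κ iota g (fun c hc => hcns g c hc) hu

/-- Working form of `hΘU` at the record: for `ϑ ∈ ∞θ^ι_env` with `ϑ ^ n = v · θ` (previous lemma), `act g θ = θ`, units
`act g`-stable and `M^×_TM` saturated in the ambient module, `(act g ϑ · ϑ⁻¹) ^ n = act g v · v⁻¹ ∈ M^×_TM`, hence
`act g ϑ = u · ϑ` with `u := act g ϑ · ϑ⁻¹ ∈ M^×_TM`. [claim: Mochizuki2012, status: disputed] (IUTchII §3 Cor 3.5 (ii), kurims p.95) -/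
theorem hThetaU_toRecord' (ι : Iota) {θ : Multiplicative T.cohEnv.lim} (g : Sys.PiX)
    (horb : ∀ θ' : Multiplicative T.cohEnv.lim, θ' ∈ (T.toRecord act κ iota).thetaEnv ι →
      ∃ u : Multiplicative T.cohEnv.lim, u ∈ (T.toRecord act κ iota).units ∧ θ' = u * θ)
    (htors : ∀ u : Multiplicative T.cohEnv.lim, IsOfFinOrder u → u ∈ (T.toRecord act κ iota).units)
    (hfix : act g θ = θ)
    (hunits : ∀ u : Multiplicative T.cohEnv.lim, u ∈ (T.toRecord act κ iota).units →
      act g u ∈ (T.toRecord act κ iota).units)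
    (hsat : ∀ (x : Multiplicative T.cohEnv.lim) (n : ℕ), 0 < n →
      x ^ n ∈ (T.toRecord act κ iota).units → x ∈ (T.toRecord act κ iota).units)
    {ϑ : Multiplicative T.cohEnv.lim} (hϑ : ϑ ∈ (T.toRecord act κ iota).inftyThetaEnv ι) :
    ∃ u : Multiplicative T.cohEnv.lim, u ∈ (T.toRecord act κ iota).units ∧ act g ϑ = u * ϑ := by
  obtain ⟨n, hn, v, hv, h⟩ := T.exists_pow_eq_unit_mul_of_mem_toRecord_inftyThetaEnv' act κ iota ι horb htors hϑ
  have hq : (act g ϑ * ϑ⁻¹) ^ n = act g v * v⁻¹ := by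
    rw [mul_pow, inv_pow, ← map_pow, h, map_mul, hfix, mul_inv_rev, mul_assoc, mul_inv_cancel_left]
  have hmem : (act g ϑ * ϑ⁻¹) ^ n ∈ (T.toRecord act κ iota).units := by
    rw [hq]
    exact (T.toRecord act κ iota).units.mul_mem (hunits v hv) ((T.toRecord act κ iota).units.inv_mem hv)
  exact ⟨act g ϑ * ϑ⁻¹, hsat _ n hn hmem, by rw [inv_mul_cancel_right]⟩

/-- **`hΘU` HOLDS at the produced record** ([IUTchII] Cor 3.5 (ii) p. 95 bracket: the conjugate of a root of `θ` by an
element fixing `θ` is the SAME root up to a unit — the binder `hΘU` of abc-iut-w5-d131's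
`inftyThetaMonoid_conjStable_of_kummer` (p416348) / abc-iut-w5-d192's Cor 3.6 (ii) `∞`-level theorem (p420309),
instantiated at `E := T.toRecord act κ iota`, for ONE group element `g`; the consumers' binder quantifies `g := s_t g'`),
GIVEN: `horb` and `htors` (as for `hroots_toRecord_of_horb`), `hfix : act g θ = θ` (the Cor 3.5 (ii) junction — a theorem at the
cohomology model, abc-iut-w4-d004 p417978), the conjugation-stability of `Ψ_cns` (Prop 3.1 (ii), `IsConjStable`), and
the saturation of `M^×_TM` in the ambient module (`hsat`: an element some positive power of which is a unit is a unit —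
at the genuine record: Kummer theory of `k̄`). [claim: Mochizuki2012, status: disputed] (IUTchII §3 Cor 3.5 (ii), kurims p.95) -/
theorem hThetaU_toRecord (ι : Iota) {θ : (T.toRecord act κ iota).H} (g : Sys.PiX)
    (horb : ∀ θ' ∈ (T.toRecord act κ iota).thetaEnv ι, ∃ u ∈ (T.toRecord act κ iota).units, θ' = u * θ)
    (htors : ∀ u : (T.toRecord act κ iota).H, IsOfFinOrder u → u ∈ (T.toRecord act κ iota).units)
    (hfix : (T.toRecord act κ iota).conj g θ = θ)
    (hcns : (T.toRecord act κ iota).IsConjStable (T.toRecord act κ iota).constantMonoid)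
    (hsat : ∀ (x : (T.toRecord act κ iota).H) (n : ℕ), 0 < n →
      x ^ n ∈ (T.toRecord act κ iota).units → x ∈ (T.toRecord act κ iota).units) :
    ∀ ϑ ∈ (T.toRecord act κ iota).inftyThetaEnv ι, ∃ u ∈ (T.toRecord act κ iota).units,
      (T.toRecord act κ iota).conj g ϑ = u * ϑ := by
  intro ϑ hϑ
  obtain ⟨u, hu, h⟩ := T.hThetaU_toRecord' act κ iota ι g (fun θ' h' => horb θ' h') (fun u hu => htors u hu) hfix
    (fun u hu => T.toRecord_units_conj_stable act κ iota hcns g hu) (fun x n hn hx => hsat x n hn hx) hϑ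
  exact ⟨u, hu, h⟩

end ThetaEnvData

end Literature.IUT.HodgeArakelov
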